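import Mathlib
import Literature.NumberTheory.LFunctions.Zhang2022.Section14Eq143Zinv
import Literature.NumberTheory.LFunctions.Zhang2022.Section14GaussSums
import HarnessLib

/-!
# Zhang (2022) §14, (14.3): moving the head `Σ_{m≤P²}` from `𝔍(1)` to the critical segment `𝔍(0)`

Topic `Literature/NumberTheory/LFunctions/Zhang2022` (Landau–Siegel adjudication tree; verdict-neutral;
cell siegel-zhang, toward the DAG deduction node `Z22:(14.3)` = `Typed.Sec14.DedEq143`).
Y. Zhang, *Discrete mean estimates and the Landau–Siegel zero*, arXiv:2211.02515v1 (2022)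
[Zhang2022LandauSiegel] — **an unrefereed manuscript under adjudication; nothing here bears on its
Theorems 1–2 or on Landau–Siegel zeros.** §14 p. 76 says (14.3) is proved "similar to the proof of
Proposition 7.1", i.e. by the argument of §7 p. 35 (tex L1894): "To handle the sum over `m < P²` we
move the path of integration to `𝔍(0)`. Hence
`|∫_{𝔍(1)} …| ≤ ∫_{𝔍(0)} |Σ_{m<P²} …| |A(…)ω(s) ds| + O(ε)`."

This file PROVES that step for the §14 integrand (theorems only; no new definition, no named fact):
`Typed.Sec14.Eq143.shift` — for `|κ*(m)| ≤ Bτ₅(m)` ((14.1), `Typed.Sec14.Eq141`) and `|a*(n)| ≤ B`,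
eventually in `D`, for every `ψ ∈ Ψ`:
`‖∫_{𝔍(1)} Z(s,ψχ)⁻¹ M(s)A(s)ω(s) ds‖ ≤ ∫_{𝔍(0)} |M(s)||A(s)ω(s)||ds| + 32e³e^{1/4}B²·e^{−𝓛¹⁰/16}`,
`M(s) = Σ_{m≤⌊P²⌋} κ*(m)ψ(m)m^{−s}`, `A(s) = Σ_{n≤⌊2P₄⌋} a*(n)ψ̄(n)n^{s−1}` (`∫_{𝔍(z)}` =
`Section7aStatements.intJ`, `∫_{𝔍(z)}|·||ds|` = `Section7aStatements.absIntJ`). The proof is L2-t2's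
`Section7aStatements.step7u018b_holds` transcribed: Cauchy's theorem on the rectangle between `𝔍(0)`
and `𝔍(1)` (`Section7aStatements.norm_intJ_sub_intJ_le`), `|Z(½+it,ψχ)| = 1` (`ψχ` primitive mod
`Dp`, `Skeleton.psiChiPrimitive_holds`), and on the horizontal sides `|Z(s,ψχ)⁻¹| ≤ e³·Dpt₀`
(`Typed.Sec14.Eq143.norm_Zfac_inv_le_of_isPrimitive`), `|M| ≤ B(P²+1)⁵`, `|A| ≤ B(2Pt₀)²`,
`|ω| ≤ 2e^{1/4}e^{−𝓛¹⁰/4}` (`Section7aStatements.norm_omegaW_side_le`), against the budget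
`D·P³t₀³(P²+1)⁵ ≤ e^{3𝓛¹⁰/16}` for `𝓛 ≥ 8406`.

## References

* Y. Zhang, arXiv:2211.02515v1 (2022), §14 (14.3) p. 76; §7 p. 35, tex L1893–1899.
  [cite: Zhang2022LandauSiegel, §14 (14.3) p. 76; §7 p. 35]
-/

noncomputable section

open Complex Real ComplexConjugate Set MeasureTheory intervalIntegral

namespace Literature.NumberTheory.LFunctions.Zhang2022.Typed.Sec14.Eq143

open Skeleton Section7aStatements

/-! ### Crude size bounds on the rectangle `½ ≤ σ ≤ 3/2` -/

/-- `τ_{j+1}(n) ≤ n^j` for `n ≥ 1` (crude: `#{d ∣ n} ≤ n`). [folklore] -/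
private theorem tau_succ_le_pow' (j : ℕ) {n : ℕ} (hn : n ≠ 0) :
    MeanSquareMajorant.tau (j + 1) n ≤ (n : ℝ) ^ j := by
  induction j generalizing n with
  | zero => rw [MeanSquareMajorant.tau_one_apply hn, pow_zero]
  | succ j ih =>
    rw [MeanSquareMajorant.tau_succ_apply]
    calc ∑ d ∈ n.divisors, MeanSquareMajorant.tau (j + 1) d
        ≤ ∑ d ∈ n.divisors, (n : ℝ) ^ j := by
          refine Finset.sum_le_sum fun d hd => (ih (Nat.pos_of_mem_divisors hd).ne').trans ?_
          exact pow_le_pow_left₀ (Nat.cast_nonneg _) (Nat.cast_le.mpr (Nat.divisor_le hd)) j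
      _ = (n.divisors.card : ℝ) * (n : ℝ) ^ j := by rw [Finset.sum_const, nsmul_eq_mul]
      _ ≤ (n : ℝ) * (n : ℝ) ^ j := by
          gcongr; exact_mod_cast Nat.card_divisors_le_self n
      _ = (n : ℝ) ^ (j + 1) := by ring

/-- `τ₅` in the shape of (14.1) is the tree's `MeanSquareMajorant.tau 5`. [folklore] -/
private theorem tau_five_eq (n : ℕ) : (((ArithmeticFunction.zeta ^ 5 : ArithmeticFunction ℕ)) n : ℝ) =
    MeanSquareMajorant.tau 5 n := by
  have h : ∀ i : ℕ, ((ArithmeticFunction.zeta ^ i : ArithmeticFunction ℕ) : ArithmeticFunction ℝ) =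
      (ArithmeticFunction.zeta : ArithmeticFunction ℝ) ^ i := by
    intro i
    induction i with
    | zero => rw [pow_zero, pow_zero, ArithmeticFunction.natCoe_one]
    | succ i ih => rw [pow_succ, pow_succ, ArithmeticFunction.natCoe_mul, ih]
  rw [MeanSquareMajorant.tau, ← h, ArithmeticFunction.natCoe_apply]

/-- **Crude bound for the head on `σ ≥ 0`**: `|Σ_{m≤⌊P²⌋} κ*(m)ψ(m)m^{−s}| ≤ B(P²+1)⁵`
(`|κ*(m)| ≤ Bτ₅(m) ≤ Bm⁴ ≤ B(P²)⁴`, `|m^{−s}| ≤ 1`). [cite: Zhang2022LandauSiegel, §7 p. 35, tex L1893] -/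
theorem norm_head_le_crude {D : ℕ} (x : Chr D) {B : ℝ} {κs : ℕ → ℂ} (hκ : Eq141 B κs) {s : ℂ}
    (hs : 0 ≤ s.re) :
    ‖∑ m ∈ Finset.Icc 1 ⌊bigP D ^ 2⌋₊, κs m * x.ψ (m : ZMod x.p) * (m : ℂ) ^ (-s)‖ ≤
      B * (bigP D ^ 2 + 1) ^ 5 := by
  set X : ℕ := ⌊bigP D ^ 2⌋₊ with hX
  have hB : 0 ≤ B := by
    have h := hκ 1
    rw [tau_five_eq, MeanSquareMajorant.tau_apply_one, mul_one] at h
    exact (norm_nonneg _).trans h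
  have hXle : (X : ℝ) ≤ bigP D ^ 2 := Nat.floor_le (by positivity)
  calc ‖∑ m ∈ Finset.Icc 1 X, κs m * x.ψ (m : ZMod x.p) * (m : ℂ) ^ (-s)‖
      ≤ ∑ m ∈ Finset.Icc 1 X, ‖κs m * x.ψ (m : ZMod x.p) * (m : ℂ) ^ (-s)‖ := norm_sum_le _ _
    _ ≤ ∑ m ∈ Finset.Icc 1 X, B * (X : ℝ) ^ 4 := by
        refine Finset.sum_le_sum fun m hm => ?_
        have hm1 : 1 ≤ m := (Finset.mem_Icc.mp hm).1
        have hmX : m ≤ X := (Finset.mem_Icc.mp hm).2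
        rw [norm_mul, norm_mul]
        have h1 : ‖κs m‖ ≤ B * MeanSquareMajorant.tau 5 m := by rw [← tau_five_eq]; exact hκ m
        have h2 : ‖x.ψ (m : ZMod x.p)‖ ≤ 1 := DirichletCharacter.norm_le_one _ _
        have h3 : ‖(m : ℂ) ^ (-s)‖ ≤ 1 := by
          rw [Complex.norm_natCast_cpow_of_pos hm1]
          exact Real.rpow_le_one_of_one_le_of_nonpos (by exact_mod_cast hm1) (by simpa using hs)
        have h4 : MeanSquareMajorant.tau 5 m ≤ (X : ℝ) ^ 4 :=
          (tau_succ_le_pow' 4 (by omega)).trans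
            (pow_le_pow_left₀ (Nat.cast_nonneg _) (Nat.cast_le.mpr hmX) 4)
        calc ‖κs m‖ * ‖x.ψ (m : ZMod x.p)‖ * ‖(m : ℂ) ^ (-s)‖ ≤ (B * MeanSquareMajorant.tau 5 m) * 1 * 1 :=
              mul_le_mul (mul_le_mul h1 h2 (norm_nonneg _)
                (mul_nonneg hB (MeanSquareMajorant.tau_nonneg _ _))) h3 (norm_nonneg _)
                (by rw [mul_one]; exact mul_nonneg hB (MeanSquareMajorant.tau_nonneg _ _))
          _ ≤ B * (X : ℝ) ^ 4 := by rw [mul_one, mul_one]; exact mul_le_mul_of_nonneg_left h4 hB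
    _ = (X : ℝ) * (B * (X : ℝ) ^ 4) := by
        rw [Finset.sum_const, Nat.card_Icc, nsmul_eq_mul]; simp
    _ ≤ (bigP D ^ 2 + 1) * (B * (bigP D ^ 2 + 1) ^ 4) := by
        have hX1 : (X : ℝ) ≤ bigP D ^ 2 + 1 := by linarith
        gcongr
    _ = B * (bigP D ^ 2 + 1) ^ 5 := by ring

/-- **Crude bound for the `a*`-polynomial on `σ ≤ 2`**: `|Σ_{n≤⌊2P₄⌋} a*(n)ψ̄(n)n^{s−1}| ≤ B(2Pt₀)²`
(`|n^{s−1}| = n^{σ−1} ≤ n ≤ 2P₄ ≤ 2Pt₀`). [cite: Zhang2022LandauSiegel, §14 (14.2) p. 76] -/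
theorem norm_apoly_le_crude {D : ℕ} (hℓ : 1 ≤ ell D) (x : Chr D) {B : ℝ} {as : ℕ → ℂ}
    (ha : ∀ n, ‖as n‖ ≤ B) {s : ℂ} (hs : s.re ≤ 2) :
    ‖∑ n ∈ Finset.Icc 1 ⌊2 * P4 D⌋₊, as n * conj (x.ψ (n : ZMod x.p)) * (n : ℂ) ^ (s - 1)‖ ≤
      B * (2 * bigP D * t0 D) ^ 2 := by
  set N : ℕ := ⌊2 * P4 D⌋₊ with hN
  have hB : 0 ≤ B := (norm_nonneg _).trans (ha 0)
  have hT1 : 1 ≤ bigT D := by rw [bigT]; exact Real.one_le_exp (by positivity)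
  have hP0 : 0 < bigP D := bigP_pos D
  have ht0 : 0 ≤ t0 D := by rw [t0]; positivity
  have hP4 : 0 ≤ 2 * P4 D := by rw [P4]; positivity
  have hNle : (N : ℝ) ≤ 2 * bigP D * t0 D := by
    refine (Nat.floor_le hP4).trans ?_
    rw [P4, show 2 * (bigP D / bigT D ^ 2 * t0 D) = 2 * bigP D * t0 D / bigT D ^ 2 by ring]
    exact div_le_self (by positivity) (one_le_pow₀ hT1)
  calc ‖∑ n ∈ Finset.Icc 1 N, as n * conj (x.ψ (n : ZMod x.p)) * (n : ℂ) ^ (s - 1)‖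
      ≤ ∑ n ∈ Finset.Icc 1 N, ‖as n * conj (x.ψ (n : ZMod x.p)) * (n : ℂ) ^ (s - 1)‖ := norm_sum_le _ _
    _ ≤ ∑ n ∈ Finset.Icc 1 N, B * (N : ℝ) := by
        refine Finset.sum_le_sum fun n hn => ?_
        have hn1 : 1 ≤ n := (Finset.mem_Icc.mp hn).1
        have hnN : n ≤ N := (Finset.mem_Icc.mp hn).2
        rw [norm_mul, norm_mul, Complex.norm_conj]
        have h2 : ‖x.ψ (n : ZMod x.p)‖ ≤ 1 := DirichletCharacter.norm_le_one _ _
        have h3 : ‖(n : ℂ) ^ (s - 1)‖ ≤ N := by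
          rw [Complex.norm_natCast_cpow_of_pos hn1]
          calc (n : ℝ) ^ (s - 1).re ≤ (n : ℝ) ^ (1 : ℝ) :=
                Real.rpow_le_rpow_of_exponent_le (by exact_mod_cast hn1)
                  (by rw [Complex.sub_re, Complex.one_re]; linarith)
            _ = n := Real.rpow_one _
            _ ≤ N := by exact_mod_cast hnN
        calc ‖as n‖ * ‖x.ψ (n : ZMod x.p)‖ * ‖(n : ℂ) ^ (s - 1)‖ ≤ B * 1 * N :=
              mul_le_mul (mul_le_mul (ha n) h2 (norm_nonneg _) hB) h3 (norm_nonneg _)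
                (by rw [mul_one]; exact hB)
          _ = B * N := by rw [mul_one]
    _ = (N : ℝ) * (B * N) := by rw [Finset.sum_const, Nat.card_Icc, nsmul_eq_mul]; simp
    _ ≤ (2 * bigP D * t0 D) * (B * (2 * bigP D * t0 D)) := by gcongr
    _ = B * (2 * bigP D * t0 D) ^ 2 := by ring

/-! ### Holomorphy of the factors -/

/-- The head `Σ_{m≤⌊P²⌋} κ*(m)ψ(m)m^{−s}` is entire. [cite: Zhang2022LandauSiegel, §7 p. 34, tex L1877] -/
theorem differentiable_head {D : ℕ} (x : Chr D) (κs : ℕ → ℂ) :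
    Differentiable ℂ fun s : ℂ =>
      ∑ m ∈ Finset.Icc 1 ⌊bigP D ^ 2⌋₊, κs m * x.ψ (m : ZMod x.p) * (m : ℂ) ^ (-s) := by
  refine Differentiable.fun_sum fun m hm => ?_
  have hm1 : (m : ℂ) ≠ 0 := Nat.cast_ne_zero.mpr (by have := (Finset.mem_Icc.mp hm).1; omega)
  exact (differentiable_const _).mul (differentiable_id.neg.const_cpow (Or.inl hm1))

/-- The `a*`-polynomial `Σ_{n≤⌊2P₄⌋} a*(n)ψ̄(n)n^{s−1}` is entire. [cite: Zhang2022LandauSiegel, §14 (14.2) p. 76] -/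
theorem differentiable_apoly {D : ℕ} (x : Chr D) (as : ℕ → ℂ) :
    Differentiable ℂ fun s : ℂ =>
      ∑ n ∈ Finset.Icc 1 ⌊2 * P4 D⌋₊, as n * conj (x.ψ (n : ZMod x.p)) * (n : ℂ) ^ (s - 1) := by
  refine Differentiable.fun_sum fun n hn => ?_
  have hn1 : (n : ℂ) ≠ 0 := Nat.cast_ne_zero.mpr (by have := (Finset.mem_Icc.mp hn).1; omega)
  exact (differentiable_const _).mul ((differentiable_id.sub_const 1).const_cpow (Or.inl hn1))

/-- `Z(s,ψχ)⁻¹` is holomorphic in the upper half-plane (`ψχ` primitive mod `Dp` for `D ≥ 3`).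
[cite: Zhang2022LandauSiegel, §4 p. 8; §2 (2.5)] -/
theorem differentiableAt_Zpc_inv {D : ℕ} [NeZero D] {χ : DirichletCharacter ℂ D} (hD : 3 ≤ D)
    (hp : χ.IsPrimitive) (x : Chr D) {s : ℂ} (hs : 0 < s.im) :
    DifferentiableAt ℂ (fun s => (Zpc χ x s)⁻¹) s :=
  (GammaFactor.differentiableAt_Zfac (psiChi χ x) hs).inv
    (GammaFactor.Zfac_ne_zero (psiChiPrimitive_holds D χ x hD hp) hs)

/-! ### The size budget of the horizontal sides -/

/-- For `𝓛 ≥ 8406`: `D·P³t₀³(P²+1)⁵ ≤ exp(3𝓛¹⁰/16)` (`D = e^{𝓛}`, `P = e^{𝓛⁹}`, `t₀ = 𝓛⁵¹⁹`).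
[cite: Zhang2022LandauSiegel, §2 p. 4–5] -/
private theorem side_budget' {D : ℕ} (hD0 : 0 < D) (hℓ : 8406 ≤ ell D) :
    (D : ℝ) * bigP D ^ 3 * t0 D ^ 3 * (bigP D ^ 2 + 1) ^ 5 ≤ Real.exp (3 * ell D ^ 10 / 16) := by
  have hℓ1 : 1 ≤ ell D := by linarith
  have hℓ0 : 0 < ell D := by linarith
  have hP : bigP D = Real.exp (ell D ^ 9) := rfl
  have ht0 : t0 D = ell D ^ 519 := rfl
  have hℓ9 : ell D ≤ ell D ^ 9 := le_self_pow₀ hℓ1 (by norm_num)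
  have hDexp : (D : ℝ) = Real.exp (ell D) := by
    rw [ell, Real.exp_log (by exact_mod_cast hD0)]
  have hD' : (D : ℝ) ≤ Real.exp (ell D ^ 9) := by rw [hDexp]; exact Real.exp_le_exp.mpr hℓ9
  have hℓexp : ell D ≤ Real.exp (ell D) := by linarith [Real.add_one_le_exp (ell D)]
  have ht : t0 D ^ 3 ≤ Real.exp (1557 * ell D ^ 9) := by
    rw [ht0, ← pow_mul]
    calc ell D ^ (519 * 3) ≤ Real.exp (ell D) ^ (519 * 3) := pow_le_pow_left₀ hℓ0.le hℓexp _
      _ = Real.exp (1557 * ell D) := by rw [← Real.exp_nat_mul]; norm_num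
      _ ≤ Real.exp (1557 * ell D ^ 9) := Real.exp_le_exp.mpr (by nlinarith)
  have hP3 : bigP D ^ 3 = Real.exp (3 * ell D ^ 9) := by rw [hP, ← Real.exp_nat_mul]; norm_num
  have hP21 : bigP D ^ 2 + 1 ≤ Real.exp (1 + 2 * ell D ^ 9) := by
    have h1 : bigP D ^ 2 = Real.exp (2 * ell D ^ 9) := by rw [hP, ← Real.exp_nat_mul]; norm_num
    rw [h1, Real.exp_add]
    have h2 : (1 : ℝ) ≤ Real.exp (2 * ell D ^ 9) := Real.one_le_exp (by positivity)
    nlinarith [Real.add_one_le_exp (1 : ℝ), Real.exp_pos (2 * ell D ^ 9)]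
  have hP21' : (bigP D ^ 2 + 1) ^ 5 ≤ Real.exp (5 + 10 * ell D ^ 9) := by
    calc (bigP D ^ 2 + 1) ^ 5 ≤ Real.exp (1 + 2 * ell D ^ 9) ^ 5 :=
          pow_le_pow_left₀ (by positivity) hP21 5
      _ = Real.exp (5 + 10 * ell D ^ 9) := by rw [← Real.exp_nat_mul]; ring_nf
  calc (D : ℝ) * bigP D ^ 3 * t0 D ^ 3 * (bigP D ^ 2 + 1) ^ 5
      ≤ Real.exp (ell D ^ 9) * Real.exp (3 * ell D ^ 9) * Real.exp (1557 * ell D ^ 9) *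
          Real.exp (5 + 10 * ell D ^ 9) := by
        have ht00 : 0 ≤ t0 D ^ 3 := by rw [ht0]; positivity
        rw [hP3]; gcongr
    _ = Real.exp (5 + 1571 * ell D ^ 9) := by
        rw [← Real.exp_add, ← Real.exp_add, ← Real.exp_add]; ring_nf
    _ ≤ Real.exp (3 * ell D ^ 10 / 16) := by
        apply Real.exp_le_exp.mpr
        have h10 : ell D ^ 10 = ell D * ell D ^ 9 := by ring
        rw [h10]
        have h9 : 1 ≤ ell D ^ 9 := one_le_pow₀ hℓ1
        nlinarith

/-! ### Moving the head from `𝔍(1)` to `𝔍(0)` -/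

/-- `2πt₀ − 𝓛₁ > 0` for `𝓛 ≥ 1`: the rectangle between `𝔍(0)` and `𝔍(1)` lies in the upper half-plane.
[cite: Zhang2022LandauSiegel, §2 (2.8)] -/
private theorem twoPiT0_sub_ell1_pos' {D : ℕ} (hℓ : 1 ≤ ell D) :
    0 < 2 * π * t0 D - ell1 D := by
  have h1 : ell D ^ 405 ≤ ell D ^ 519 := pow_le_pow_right₀ hℓ (by norm_num)
  have h2 : 1 ≤ ell D ^ 519 := one_le_pow₀ hℓ
  rw [t0, ell1]; nlinarith [Real.pi_gt_three]

/-- **The (14.3) twin of `Z22:§7.u018`** ("we move the path of integration to `𝔍(0)`", §7 p. 35, as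
invoked by §14 p. 76): for `|κ*| ≤ Bτ₅` and `|a*| ≤ B`, eventually in `D`, for every `ψ ∈ Ψ`,
`‖∫_{𝔍(1)} Z(s,ψχ)⁻¹M(s)A(s)ω(s)ds‖ ≤ ∫_{𝔍(0)}|M(s)||A(s)ω(s)||ds| + 32e³e^{1/4}B²·e^{−𝓛¹⁰/16}`,
`M(s) = Σ_{m≤⌊P²⌋}κ*(m)ψ(m)m^{−s}`, `A(s) = Σ_{n≤⌊2P₄⌋}a*(n)ψ̄(n)n^{s−1}` — Cauchy's theorem on the
rectangle (`Section7aStatements.norm_intJ_sub_intJ_le`), `|Z(½+it,ψχ)| = 1`, and on the horizontal sides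
`|Z⁻¹| ≤ e³·2DPt₀`, `|M| ≤ B(P²+1)⁵`, `|A| ≤ B(2Pt₀)²`, `|ω| ≤ 2e^{1/4}e^{−𝓛¹⁰/4}`, against
`D·P³t₀³(P²+1)⁵ ≤ e^{3𝓛¹⁰/16}` (`𝓛 ≥ 8406`). [cite: Zhang2022LandauSiegel, §14 (14.3) p. 76; §7 p. 35] -/
theorem shift (B : ℝ) : ∃ C : ℝ, ForAllLarge fun D _ χ => ∀ (x : Chr D) (κs as : ℕ → ℂ),
    Eq141 B κs → (∀ n : ℕ, ‖as n‖ ≤ B) →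
      ‖intJ D 1 (fun s => (Zpc χ x s)⁻¹ *
          (∑ m ∈ Finset.Icc 1 ⌊bigP D ^ 2⌋₊, κs m * x.ψ (m : ZMod x.p) * (m : ℂ) ^ (-s)) *
          (∑ n ∈ Finset.Icc 1 ⌊2 * P4 D⌋₊,
            as n * conj (x.ψ (n : ZMod x.p)) * (n : ℂ) ^ (s - 1)) * omegaW D s)‖ ≤
        absIntJ D 0 (fun s =>
          (∑ m ∈ Finset.Icc 1 ⌊bigP D ^ 2⌋₊, κs m * x.ψ (m : ZMod x.p) * (m : ℂ) ^ (-s)) *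
            ((∑ n ∈ Finset.Icc 1 ⌊2 * P4 D⌋₊,
              as n * conj (x.ψ (n : ZMod x.p)) * (n : ℂ) ^ (s - 1)) * omegaW D s)) +
          C * Real.exp (-(1 / 16) * ell D ^ 10) := by
  obtain ⟨D₁, hD₁⟩ := exists_nat_forall_le_ell 8406
  refine ⟨32 * Real.exp 3 * Real.exp (1 / 4) * B ^ 2, max 3 D₁,
    fun D _ χ hD _ hp x κs as hκ ha => ?_⟩
  have hD3 : 3 ≤ D := le_trans (le_max_left _ _) hD
  have hD0 : 0 < D := by omega
  have hℓbig : 8406 ≤ ell D := hD₁ D (le_trans (le_max_right _ _) hD)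
  have hℓ : 1 ≤ ell D := by linarith
  have hℓ9 : 1 ≤ ell D ^ 9 := one_le_pow₀ hℓ
  have hL0 : 0 ≤ ell1 D := by rw [ell1]; positivity
  have hside : 0 < 2 * π * t0 D - ell1 D := twoPiT0_sub_ell1_pos' hℓ
  have hP0 : 0 < bigP D := bigP_pos D
  have hB : 0 ≤ B := (norm_nonneg _).trans (ha 0)
  have ht01 : 1 ≤ t0 D := by rw [t0]; exact one_le_pow₀ hℓ
  have hprim : (psiChi χ x).IsPrimitive := psiChiPrimitive_holds D χ x hD3 hp
  have hk2 : 2 ≤ D * x.p := le_trans x.prime.two_le (Nat.le_mul_of_pos_left _ hD0)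
  have hp2P : (x.p : ℝ) ≤ 2 * bigP D := le_two_mul_bigP_of_mem_primeWindow hℓ x.mem
  have hkt1 : 1 ≤ ((D * x.p : ℕ) : ℝ) * t0 D := by
    have hk1 : (1 : ℝ) ≤ ((D * x.p : ℕ) : ℝ) := by exact_mod_cast le_trans one_le_two hk2
    nlinarith
  have hkle : ((D * x.p : ℕ) : ℝ) * t0 D ≤ 2 * (D : ℝ) * bigP D * t0 D := by
    push_cast
    have hD' : (0 : ℝ) ≤ D := Nat.cast_nonneg D
    nlinarith [mul_nonneg hD' (zero_le_one.trans ht01)]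
  -- the integrand and its holomorphy on the closed rectangle `½ ≤ σ ≤ 3/2`, `|t − 2πt₀| ≤ 𝓛₁`
  set Mf : ℂ → ℂ := fun s =>
    ∑ m ∈ Finset.Icc 1 ⌊bigP D ^ 2⌋₊, κs m * x.ψ (m : ZMod x.p) * (m : ℂ) ^ (-s) with hMf
  set Af : ℂ → ℂ := fun s =>
    ∑ n ∈ Finset.Icc 1 ⌊2 * P4 D⌋₊, as n * conj (x.ψ (n : ZMod x.p)) * (n : ℂ) ^ (s - 1) with hAf
  set F : ℂ → ℂ := fun s => (Zpc χ x s)⁻¹ * Mf s * Af s * omegaW D s with hF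
  have hdiff : DifferentiableOn ℂ F (Set.uIcc (1 / 2 + (0 : ℝ)) (1 / 2 + 1) ×ℂ
      Set.uIcc (2 * π * t0 D - ell1 D) (2 * π * t0 D + ell1 D)) := by
    intro s hs
    have him : 0 < s.im := by
      have h := (Complex.mem_reProdIm.mp hs).2
      rw [Set.uIcc_of_le (by linarith)] at h
      linarith [h.1]
    exact ((((differentiableAt_Zpc_inv hD3 hp x him).mul ((differentiable_head x κs) s)).mul
      ((differentiable_apoly x as) s)).mul ((differentiable_omegaW D) s)).differentiableWithinAt
  -- Step 1: on `𝔍(0)`, `|Z(s,ψχ)⁻¹| = 1`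
  have h0 : ‖intJ D 0 F‖ ≤ absIntJ D 0 (fun s => Mf s * (Af s * omegaW D s)) := by
    refine (norm_intJ_le_absIntJ D hL0 0 F).trans (le_of_eq ?_)
    rw [absIntJ, absIntJ]
    refine intervalIntegral.integral_congr fun v hv => ?_
    have hv' : -ell1 D ≤ v := by
      rw [Set.uIcc_of_le (by linarith)] at hv; exact hv.1
    have hpt : ((0 : ℝ) : ℂ) + s0 D + v * I = 1 / 2 + ((2 * π * t0 D + v : ℝ) : ℂ) * I := by
      rw [s0, SmoothWeight.s0_def]; push_cast; ring
    have hZ : ‖(Zpc χ x (((0 : ℝ) : ℂ) + s0 D + v * I))⁻¹‖ = 1 := by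
      rw [hpt, Zpc, norm_inv, GammaFactor.norm_Zfac_half_eq_one hprim (by linarith), inv_one]
    show ‖F _‖ = _
    simp only [hF, norm_mul, hZ, one_mul, mul_assoc]
  -- Step 2: the horizontal sides `t = 2πt₀ + v`, `v = ±𝓛₁`, `½ ≤ σ ≤ 3/2`
  set M : ℝ := Real.exp 3 * (2 * (D : ℝ) * bigP D * t0 D) * (B * (bigP D ^ 2 + 1) ^ 5) *
    (B * (2 * bigP D * t0 D) ^ 2) * (2 * Real.exp (1 / 4) * Real.exp (-(ell D ^ 10 / 4))) with hMdef
  have hM : ∀ u ∈ Set.Icc (1 / 2 + (0 : ℝ)) (1 / 2 + 1), ∀ v : ℝ, v ^ 2 = ell1 D ^ 2 →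
      ‖F ((u : ℂ) + ((2 * π * t0 D + v : ℝ) : ℂ) * I)‖ ≤ M := by
    intro u hu v hv
    have hu0 : 1 / 2 ≤ u := by linarith [hu.1]
    have hu1 : u ≤ 3 / 2 := by linarith [hu.2]
    have habs : |v| = ell1 D := by
      have h := (sq_eq_sq_iff_abs_eq_abs v (ell1 D)).mp hv
      rwa [abs_of_nonneg hL0] at h
    have hsre : ((u : ℂ) + ((2 * π * t0 D + v : ℝ) : ℂ) * I).re = u := by simp
    have hsim : ((u : ℂ) + ((2 * π * t0 D + v : ℝ) : ℂ) * I).im = 2 * π * t0 D + v := by simp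
    have hZ : ‖(Zpc χ x ((u : ℂ) + ((2 * π * t0 D + v : ℝ) : ℂ) * I))⁻¹‖ ≤
        Real.exp 3 * (2 * (D : ℝ) * bigP D * t0 D) := by
      have h := norm_Zfac_inv_le_of_isPrimitive hD3 hprim hk2
        (s := (u : ℂ) + ((2 * π * t0 D + v : ℝ) : ℂ) * I)
        (by rw [hsre]; exact hu0) (by rw [hsre]; linarith)
        (by rw [hsim, show 2 * π * t0 D + v - 2 * π * t0 D = v by ring, habs])
      rw [hsre] at h
      rw [Zpc]
      refine h.trans (mul_le_mul_of_nonneg_left ?_ (Real.exp_pos 3).le)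
      calc (((D * x.p : ℕ) : ℝ) * t0 D) ^ (u - 1 / 2) ≤ (((D * x.p : ℕ) : ℝ) * t0 D) ^ (1 : ℝ) :=
            Real.rpow_le_rpow_of_exponent_le hkt1 (by linarith)
        _ = ((D * x.p : ℕ) : ℝ) * t0 D := Real.rpow_one _
        _ ≤ 2 * (D : ℝ) * bigP D * t0 D := hkle
    have hH : ‖Mf ((u : ℂ) + ((2 * π * t0 D + v : ℝ) : ℂ) * I)‖ ≤ B * (bigP D ^ 2 + 1) ^ 5 :=
      norm_head_le_crude x hκ (by rw [hsre]; linarith)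
    have hA : ‖Af ((u : ℂ) + ((2 * π * t0 D + v : ℝ) : ℂ) * I)‖ ≤ B * (2 * bigP D * t0 D) ^ 2 :=
      norm_apoly_le_crude hℓ x ha (by rw [hsre]; linarith)
    have hω : ‖omegaW D ((u : ℂ) + ((2 * π * t0 D + v : ℝ) : ℂ) * I)‖ ≤
        2 * Real.exp (1 / 4) * Real.exp (-(ell D ^ 10 / 4)) :=
      norm_omegaW_side_le hD3 hu0 (by linarith) hv
    have hPt : 0 ≤ 2 * bigP D * t0 D := mul_nonneg (mul_nonneg zero_le_two hP0.le) (zero_le_one.trans ht01)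
    have hK0 : 0 ≤ Real.exp 3 * (2 * (D : ℝ) * bigP D * t0 D) := by
      refine mul_nonneg (Real.exp_pos 3).le ?_
      have : 2 * (D : ℝ) * bigP D * t0 D = (D : ℝ) * (2 * bigP D * t0 D) := by ring
      rw [this]; exact mul_nonneg (Nat.cast_nonneg D) hPt
    have hK1 : 0 ≤ B * (bigP D ^ 2 + 1) ^ 5 := mul_nonneg hB (by positivity)
    have hK2 : 0 ≤ B * (2 * bigP D * t0 D) ^ 2 := mul_nonneg hB (pow_nonneg hPt 2)
    have e1 := mul_le_mul hZ hH (norm_nonneg _) hK0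
    have e2 := mul_le_mul e1 hA (norm_nonneg _) (mul_nonneg hK0 hK1)
    have e3 := mul_le_mul e2 hω (norm_nonneg _) (mul_nonneg (mul_nonneg hK0 hK1) hK2)
    show ‖F _‖ ≤ M
    simp only [hF, norm_mul, hMdef]
    exact e3
  -- Step 3: Cauchy's theorem between `𝔍(0)` and `𝔍(1)`
  have hshift : ‖intJ D 1 F - intJ D 0 F‖ ≤ (1 - 0) * (M + M) := by
    refine norm_intJ_sub_intJ_le D (by norm_num) hdiff (fun u hu => hM u hu _ rfl) fun u hu => ?_
    have e : (2 * π * t0 D - ell1 D : ℝ) = 2 * π * t0 D + -ell1 D := by ring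
    rw [e]
    exact hM u hu _ (by ring)
  have hbud := side_budget' hD0 hℓbig
  have h2M : (1 - 0) * (M + M) ≤
      32 * Real.exp 3 * Real.exp (1 / 4) * B ^ 2 * Real.exp (-(1 / 16) * ell D ^ 10) := by
    have e : (1 - 0) * (M + M) = 32 * Real.exp 3 * Real.exp (1 / 4) * B ^ 2 *
        (((D : ℝ) * bigP D ^ 3 * t0 D ^ 3 * (bigP D ^ 2 + 1) ^ 5) *
          Real.exp (-(ell D ^ 10 / 4))) := by
      rw [hMdef]; ring
    have e2 : Real.exp (-(1 / 16) * ell D ^ 10) =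
        Real.exp (3 * ell D ^ 10 / 16) * Real.exp (-(ell D ^ 10 / 4)) := by
      rw [← Real.exp_add]; ring_nf
    rw [e, e2]
    gcongr
  calc ‖intJ D 1 F‖ = ‖intJ D 0 F + (intJ D 1 F - intJ D 0 F)‖ := by rw [add_sub_cancel]
    _ ≤ ‖intJ D 0 F‖ + ‖intJ D 1 F - intJ D 0 F‖ := norm_add_le _ _
    _ ≤ absIntJ D 0 (fun s => Mf s * (Af s * omegaW D s)) +
        32 * Real.exp 3 * Real.exp (1 / 4) * B ^ 2 * Real.exp (-(1 / 16) * ell D ^ 10) :=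
        add_le_add h0 (hshift.trans h2M)

end Literature.NumberTheory.LFunctions.Zhang2022.Typed.Sec14.Eq143

end
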